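import Summits.QuantumFields.YangMills.Theorems.BalabanUVNodesN15KingModelAnalyticDeterminantRealSlice
import Summits.QuantumFields.YangMills.Theorems.BalabanUVNodesN15KingModelCovariantBlockFieldDomination
import Summits.QuantumFields.YangMills.Theorems.BalabanUVNodesN15KingModelCovariantRandomWalk
import Summits.QuantumFields.YangMills.Theorems.BalabanUVNodesN15KingModelBoxSumRulesResolvent
import HarnessLib

/-!
# BalabanUVNodes ∕ N15 — THE KING-MODEL RUNG (PART Ϭ-e): A DIAMAGNETIC-TYPE FLOOR FOR THE BLOCK-FIELD NORMALISATION — KING's FLAT DIAGONAL COVARIANCE CONTROLS `det Δ_eff(U)` FROM BELOW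
# AT EVERY UNITARY BACKGROUND: `(|T₁| ∕ tr (Δ^{(K)})⁻¹)^{N} ≤ det Δ_eff(U)`, i.e. `det C(U) ≤ (mean diagonal entry of King's `A = 0` block covariance)^{N}` (AM–GM on the spectrum of the
# positive definite `C(U) = (Δ_eff(U))⁻¹` + PART Ϥ-l's Kato majorisation `‖C(U)_{yy}‖ ≤ (Δ^{(K)})⁻¹(y,y)`); the flat diagonal entry is `≤ a⁻¹ + m⁻²` (row sum `1∕m²` of the massive lattice Green's
# function), so this floor implies PART Ϭ-b's; for real-orthogonal backgrounds the block-field Gaussian integral is at most King's AM–GM value `√(2π)^{N}·(tr (Δ^{(K)})⁻¹ ∕ |T₁|)^{N∕2}`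
# (Track A, DAG node N15 = NE2; FAN-OUT v1.1 §N15 s3 «KING-MODEL RUNG … + what the curved case adds»; count-neutral)

HONEST FRAMING.  Count-neutral (cell `pub-ymgap`, seat `pub-ymgap-dag-n15-e` g53; `--supports stmt-QuantumFields-27247 --as helper` = K3ᴬ, KEY MAP v3).  King's one-level comparison model in
King's scaling `c = L²` (PART Ϥ-l's majorisation is typed there), `a, m² > 0`, unitary backgrounds; AM–GM gives a TRACE (mean-eigenvalue) ceiling for `det C(U)` — it is NOT the statement
`det Δ_eff(U) ≥ det Δ_eff(1)` (a genuine diamagnetic inequality for the block field, which is not claimed); the same AM–GM ceiling bounds the flat case too.  NOT Bałaban's multi-level objects;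
NOT a node discharge (N15 of record untouched); nothing continuum ∕ ℝ⁴ ∕ OS ∕ Clay.

THE RESULTS (unitary `U`, `L ≥ 1`, `a, m² > 0`, `N = |T₁|·|n|`, `C(U) = (Δ_eff(U))⁻¹`, `K = (Δ^{(K)})⁻¹` King's flat block covariance on `T₁`):
* §1 ★★ `re_diag_effLapU_inv_le_king` (`Re C(U)_{(y,i),(y,i)} ≤ K(y,y)`), ★★★ **`re_trace_effLapU_inv_le_king`** (`Re tr C(U) ≤ |n|·tr K` — the curved block-field covariance has trace at most
  King's flat one, fibre by fibre).
* §2 `sum_lapF_inv_sites_le_inv_mass` (`Σ_{j′}G(x, x_{j′}(y)) ≤ 1∕m²`), ★★ **`effLaplacian_inv_diag_le`** (`K(y,y) ≤ a⁻¹ + m⁻²` — block mean of the Green's function row sum), `effLaplacian_inv_diag_pos`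
  (the lower bound `a⁻¹ ≤ K(y,y)`, whence positivity), ★★ `trace_effLaplacian_inv_le` (`tr K ≤ |T₁|(a⁻¹+m⁻²)`), `trace_effLaplacian_inv_pos`.
* §3 ★★ `re_det_effLapU_inv_le_pow_king` (AM–GM: `Re det C(U) ≤ (tr K ∕ |T₁|)^{N}`), ★★★★ **`pow_le_re_det_effLapU_king`** (`(|T₁| ∕ tr K)^{N} ≤ det Δ_eff(U)` — THE FLOOR), ★★ `floor_king_ge_floor_sharp`
  (`(a⁻¹+m⁻²)⁻¹ ≤ |T₁| ∕ tr K`: this floor implies Ϭ-b's), ★★★ **`gaussNorm_effLapU_le_king`** (`𝕜 = ℝ`: `𝒩(Δ_eff(U)) ≤ √(2π)^{N}·(tr K ∕ |T₁|)^{N∕2}` — the curved block-field Gaussian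
  integral is at most King's AM–GM value, at every real-orthogonal background).
PRIOR TREE ART (by name): Ϥ-l (`norm_blk_effLapU_inv_le_king`, `king_blockCov_sub_noise_apply`), Ͱ-d (`norm_entry_le_l2_opNorm_blk`), Ͱ-b (`lapF_inv_entry_nonneg`), Ε-box (`sum_lapF_inv_eq_inv_mass`),
Ͱ-c (`PosDef.re_det_le_pow`), Ϭ-b (`posDef_effLapU`, `gaussNorm_effLapU_eq`), Ϭ-a (`re_det_effLapU_pos`, `det_effLapU_eq_ofReal_re`), `King1986.Torus` (`site`, `site_injective`, `effLaplacian`),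
Mathlib (`Matrix.PosDef.inv`, `Matrix.det_nonsing_inv`, `Finset.sum_le_sum_of_subset_of_nonneg`).  Dedup (rg at filing): basename 0 files; needles
`re_trace_effLapU_inv_le_king|effLaplacian_inv_diag_le|pow_le_re_det_effLapU_king|gaussNorm_effLapU_le_king|floor_king_ge_floor_sharp` 0 tree files.  Locators: [King1986] (2.6) p.652, (2.13)–(2.14) p.653,
(2.17) p.653, (3.89) p.668, (4.33) p.674, (4.44)–(4.45) p.675; [Balaban1985BackgroundPropagators] (3.19) p.393, (3.25) p.394; [Balaban1982Higgs2] (3.37)–(3.38) p.591 (the diamagnetic shape).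
0 `sorry`, 0 `def`.  v1.1 (DOC-ONLY, ERRATUM-Ϭ2, ref-I READ-1093 N1∕N2): `effLaplacian_inv_diag_pos` glossed as the lower bound it states; `sum_lapF_inv_sites_le_inv_mass` binds `[NeZero L]`
(docstring «`L ≠ 0`», v1.0 said «`L ≥ 1`» — equivalent on ℕ); declarations byte-identical.
-/

noncomputable section
open scoped BigOperators ComplexConjugate ComplexOrder Matrix.Norms.L2Operator
open Finset Matrix WithLp MeasureTheory

namespace Summit.QuantumFields.YangMills.BalabanUVNodes.N15KingModelRung.Analytic

open Literature.MathematicalPhysics.QuantumFieldTheory.LatticeDiamagneticInequality (blk)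
open Literature.MathematicalPhysics.QuantumFieldTheory.Balaban1983to89.B5Prop11Plancherel (Tor fine)
open Literature.MathematicalPhysics.QuantumFieldTheory.King1986.Torus (site site_injective lapF effLaplacian)
open Summit.QuantumFields.YangMills.BalabanUVNodes.N15KingModelRung.Covariant (norm_entry_le_l2_opNorm_blk lapF_inv_entry_nonneg)
open Summit.QuantumFields.YangMills.BalabanUVNodes.N15KingModelRung.CovariantBlock (BlockTree effLapU norm_blk_effLapU_inv_le_king king_blockCov_sub_noise_apply)
open Summit.QuantumFields.YangMills.BalabanUVNodes.N15KingModelRung.TorusSpectral (sum_lapF_inv_eq_inv_mass)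
open Summit.QuantumFields.YangMills.BalabanUVNodes.N15KingModelRung.FreeField (gaussNorm)

variable {d : ℕ} {L : ℕ} [NeZero L] (T : BlockTree d L) (M : Fin (d + 1) → ℕ) [hM : ∀ μ, NeZero (M μ)]

/-! ## §1 The trace of the curved block-field covariance is at most King's flat trace -/

section Trace

variable {𝕜 : Type*} [RCLike 𝕜] {n : Type*} [Fintype n] [DecidableEq n]
variable (hL : 1 ≤ L) {a m2 : ℝ} (ha : 0 < a) (hm : 0 < m2) {U : Tor (fine L M) × Fin (d + 1) → Matrix n n 𝕜} (hU : ∀ bd, U bd ∈ Matrix.unitaryGroup n 𝕜)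
include hL ha hm hU

/-- ★★ **EVERY DIAGONAL ENTRY OF THE CURVED BLOCK-FIELD COVARIANCE IS AT MOST KING's FLAT ONE**: `Re C(U)_{(y,i),(y,i)} ≤ (Δ^{(K)})⁻¹(y,y)` (entry ≤ block operator norm ≤ PART Ϥ-l's majorant).
[cite: King1986, (2.14) p.653, (4.45) p.675; Balaban1985BackgroundPropagators, (3.25) p.394] -/
theorem re_diag_effLapU_inv_le_king (y : Tor M) (i : n) :
    RCLike.re (((effLapU T M a ((L : ℝ) ^ 2) m2 U)⁻¹) (y, i) (y, i)) ≤ (effLaplacian L M a ((L : ℝ) ^ 2) m2)⁻¹ y y :=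
  (RCLike.re_le_norm _).trans ((norm_entry_le_l2_opNorm_blk M _ y y i i).trans (norm_blk_effLapU_inv_le_king T M hL ha hm hU y y))

/-- ★★★ **`Re tr C(U) ≤ |n|·tr (Δ^{(K)})⁻¹`** at every unitary background — the curved block-field covariance has trace at most King's flat one, fibre component by fibre component.
[cite: King1986, (2.14) p.653, (4.45) p.675; Balaban1985BackgroundPropagators, (3.25) p.394] -/
theorem re_trace_effLapU_inv_le_king :
    RCLike.re ((effLapU T M a ((L : ℝ) ^ 2) m2 U)⁻¹).trace ≤ Fintype.card n * ((effLaplacian L M a ((L : ℝ) ^ 2) m2)⁻¹).trace := by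
  rw [Matrix.trace, Matrix.trace, map_sum, Fintype.sum_prod_type, Finset.mul_sum]
  refine Finset.sum_le_sum fun y _ => ?_
  calc ∑ i : n, RCLike.re (Matrix.diag ((effLapU T M a ((L : ℝ) ^ 2) m2 U)⁻¹) (y, i)) ≤ ∑ _i : n, (effLaplacian L M a ((L : ℝ) ^ 2) m2)⁻¹ y y :=
        Finset.sum_le_sum fun i _ => re_diag_effLapU_inv_le_king T M hL ha hm hU y i
    _ = Fintype.card n * Matrix.diag ((effLaplacian L M a ((L : ℝ) ^ 2) m2)⁻¹) y := by rw [Finset.sum_const, Finset.card_univ, nsmul_eq_mul, Matrix.diag_apply]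

end Trace

/-! ## §2 King's flat diagonal entry is between `a⁻¹` and `a⁻¹ + m⁻²` -/

section Flat

variable (hL : 1 ≤ L) {a m2 : ℝ} (ha : 0 < a) (hm : 0 < m2)
include hm

omit [NeZero L] in
/-- `Σ_{j′}G(x, x_{j′}(y)) ≤ Σ_{x′}G(x,x′) = 1∕m²` — part of a row of the non-negative massive Green's function (`L ≠ 0`). [cite: King1986, (2.17) p.653, (4.4) p.670] -/
theorem sum_lapF_inv_sites_le_inv_mass [NeZero L] {c : ℝ} (hc : 0 ≤ c) (x : Tor (fine L M)) (y : Tor M) :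
    ∑ j' : Fin (d + 1) → Fin L, (lapF (fine L M) c m2)⁻¹ x (site L M y j') ≤ m2⁻¹ := by
  have hinj : Function.Injective (fun j' : Fin (d + 1) → Fin L => site L M y j') := by
    intro j₁ j₂ h
    have := site_injective (L := L) (M := M) (show (fun bj : Tor M × (Fin (d + 1) → Fin L) => site L M bj.1 bj.2) (y, j₁) = (fun bj => site L M bj.1 bj.2) (y, j₂) from h)
    exact (Prod.mk.inj this).2
  rw [← sum_lapF_inv_eq_inv_mass (fine L M) hc hm x, ← Finset.sum_image (f := fun x' => (lapF (fine L M) c m2)⁻¹ x x') (fun j₁ _ j₂ _ h => hinj h)]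
  exact Finset.sum_le_sum_of_subset_of_nonneg (Finset.subset_univ _) fun x' _ _ => lapF_inv_entry_nonneg (fine L M) hc hm x x'

include hL ha

/-- ★★ **KING's FLAT DIAGONAL BLOCK COVARIANCE IS AT MOST `a⁻¹ + m⁻²`**: `(Δ^{(K)})⁻¹(y,y) ≤ a⁻¹ + m⁻²` (PART Ϥ-l's explicit form `a⁻¹ + L^{−(d+1)}Σ_{j,j′}G(x_j,x_{j′})` and the row sum `1∕m²`).
[cite: King1986, (2.14) p.653, (4.44)–(4.45) p.675] -/
theorem effLaplacian_inv_diag_le (y : Tor M) : (effLaplacian L M a ((L : ℝ) ^ 2) m2)⁻¹ y y ≤ a⁻¹ + m2⁻¹ := by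
  have hLd : (0 : ℝ) < (L : ℝ) ^ (d + 1) := by positivity
  have h := king_blockCov_sub_noise_apply M hL ha hm y y
  rw [Matrix.sub_apply, Matrix.smul_apply, Matrix.one_apply_eq, smul_eq_mul, mul_one, sub_eq_iff_eq_add] at h
  rw [h, add_comm]
  gcongr
  calc ((L : ℝ) ^ (d + 1))⁻¹ * ∑ j : Fin (d + 1) → Fin L, ∑ j' : Fin (d + 1) → Fin L, (lapF (fine L M) ((L : ℝ) ^ 2) m2)⁻¹ (site L M y j) (site L M y j')
        ≤ ((L : ℝ) ^ (d + 1))⁻¹ * ∑ _j : Fin (d + 1) → Fin L, m2⁻¹ := by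
          gcongr with j _
          exact sum_lapF_inv_sites_le_inv_mass M hm (by positivity) _ _
    _ = m2⁻¹ := by
          rw [Finset.sum_const, Finset.card_univ, Fintype.card_fun, Fintype.card_fin, Fintype.card_fin, nsmul_eq_mul]
          push_cast
          field_simp

/-- `a⁻¹ ≤ (Δ^{(K)})⁻¹(y,y)` (the block-spin noise plus a non-negative Green's function average). [cite: King1986, (2.14) p.653, (4.44)–(4.45) p.675] -/
theorem effLaplacian_inv_diag_pos (y : Tor M) : a⁻¹ ≤ (effLaplacian L M a ((L : ℝ) ^ 2) m2)⁻¹ y y := by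
  have h := king_blockCov_sub_noise_apply M hL ha hm y y
  rw [Matrix.sub_apply, Matrix.smul_apply, Matrix.one_apply_eq, smul_eq_mul, mul_one, sub_eq_iff_eq_add] at h
  rw [h]
  have : 0 ≤ ((L : ℝ) ^ (d + 1))⁻¹ * ∑ j : Fin (d + 1) → Fin L, ∑ j' : Fin (d + 1) → Fin L, (lapF (fine L M) ((L : ℝ) ^ 2) m2)⁻¹ (site L M y j) (site L M y j') :=
    mul_nonneg (by positivity) (Finset.sum_nonneg fun _ _ => Finset.sum_nonneg fun _ _ => lapF_inv_entry_nonneg (fine L M) (by positivity) hm _ _)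
  linarith

/-- ★★ **`tr (Δ^{(K)})⁻¹ ≤ |T₁|·(a⁻¹ + m⁻²)`**. [cite: King1986, (2.14) p.653, (4.45) p.675] -/
theorem trace_effLaplacian_inv_le : ((effLaplacian L M a ((L : ℝ) ^ 2) m2)⁻¹).trace ≤ Fintype.card (Tor M) * (a⁻¹ + m2⁻¹) := by
  rw [Matrix.trace]
  calc ∑ y, Matrix.diag ((effLaplacian L M a ((L : ℝ) ^ 2) m2)⁻¹) y ≤ ∑ _y : Tor M, (a⁻¹ + m2⁻¹) := Finset.sum_le_sum fun y _ => effLaplacian_inv_diag_le M hL ha hm y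
    _ = Fintype.card (Tor M) * (a⁻¹ + m2⁻¹) := by rw [Finset.sum_const, Finset.card_univ, nsmul_eq_mul]

/-- `0 < tr (Δ^{(K)})⁻¹` (indeed `≥ |T₁|·a⁻¹`). [cite: King1986, (2.14) p.653] -/
theorem trace_effLaplacian_inv_pos : 0 < ((effLaplacian L M a ((L : ℝ) ^ 2) m2)⁻¹).trace := by
  have hT : 0 < Fintype.card (Tor M) := Fintype.card_pos
  rw [Matrix.trace]
  calc (0 : ℝ) < ∑ _y : Tor M, a⁻¹ := by rw [Finset.sum_const, Finset.card_univ, nsmul_eq_mul]; positivity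
    _ ≤ ∑ y, Matrix.diag ((effLaplacian L M a ((L : ℝ) ^ 2) m2)⁻¹) y := Finset.sum_le_sum fun y _ => effLaplacian_inv_diag_pos M hL ha hm y

end Flat

/-! ## §3 AM–GM: the floor for `det Δ_eff(U)` from King's flat trace -/

section Floor

variable {𝕜 : Type*} [RCLike 𝕜] {n : Type*} [Fintype n] [DecidableEq n] [Nonempty n]
variable (hL : 1 ≤ L) {a m2 : ℝ} (ha : 0 < a) (hm : 0 < m2) {U : Tor (fine L M) × Fin (d + 1) → Matrix n n 𝕜} (hU : ∀ bd, U bd ∈ Matrix.unitaryGroup n 𝕜)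
include hL ha hm hU

/-- ★★ **AM–GM ON THE SPECTRUM OF `C(U)`**: `Re det C(U) ≤ (Re tr C(U) ∕ N)^{N} ≤ (tr (Δ^{(K)})⁻¹ ∕ |T₁|)^{N}`. [cite: King1986, (2.14) p.653, (3.89) p.668, (4.45) p.675] -/
theorem re_det_effLapU_inv_le_pow_king :
    RCLike.re ((effLapU T M a ((L : ℝ) ^ 2) m2 U)⁻¹).det ≤ (((effLaplacian L M a ((L : ℝ) ^ 2) m2)⁻¹).trace / Fintype.card (Tor M)) ^ Fintype.card (Tor M × n) := by
  have hc : (0 : ℝ) ≤ (L : ℝ) ^ 2 := by positivity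
  have hPD : ((effLapU T M a ((L : ℝ) ^ 2) m2 U)⁻¹).PosDef := (posDef_effLapU T M ha hc hm hU).inv
  have h1 := Covariant.PosDef.re_det_le_pow hPD
  have hN : (0 : ℝ) < Fintype.card (Tor M × n) := by exact_mod_cast Fintype.card_pos
  have hT : (0 : ℝ) < Fintype.card (Tor M) := by exact_mod_cast Fintype.card_pos
  have htr := re_trace_effLapU_inv_le_king T M hL ha hm hU
  have hnonneg : 0 ≤ RCLike.re ((effLapU T M a ((L : ℝ) ^ 2) m2 U)⁻¹).trace / Fintype.card (Tor M × n) := by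
    have : 0 ≤ RCLike.re ((effLapU T M a ((L : ℝ) ^ 2) m2 U)⁻¹).trace := by
      rw [Covariant.IsHermitian.re_trace_eq_sum_eigenvalues hPD.1]
      exact Finset.sum_nonneg fun i _ => (hPD.eigenvalues_pos i).le
    positivity
  refine h1.trans (pow_le_pow_left₀ hnonneg ?_ _)
  rw [div_le_div_iff₀ hN hT, Fintype.card_prod]
  push_cast
  nlinarith [htr, hT]

/-- ★★★★ **THE FLOOR: `(|T₁| ∕ tr (Δ^{(K)})⁻¹)^{N} ≤ det Δ_eff(U)` AT EVERY UNITARY BACKGROUND** — King's flat diagonal block covariance controls the curved block-field normalisation from below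
(`det Δ_eff = (det C)⁻¹`). [cite: King1986, (2.6) p.652, (2.14) p.653, (3.89) p.668, (4.45) p.675; Balaban1982Higgs2, (3.37)–(3.38) p.591 (shape)] -/
theorem pow_le_re_det_effLapU_king :
    (Fintype.card (Tor M) / ((effLaplacian L M a ((L : ℝ) ^ 2) m2)⁻¹).trace) ^ Fintype.card (Tor M × n) ≤ RCLike.re (effLapU T M a ((L : ℝ) ^ 2) m2 U).det := by
  have hc : (0 : ℝ) ≤ (L : ℝ) ^ 2 := by positivity
  have htr := trace_effLaplacian_inv_pos M hL ha hm
  have hT : (0 : ℝ) < Fintype.card (Tor M) := by exact_mod_cast Fintype.card_pos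
  have hΔ := re_det_effLapU_pos T M ha hc hm hU
  have h1 := re_det_effLapU_inv_le_pow_king T M hL ha hm hU
  -- `Re det C = (Re det Δ)⁻¹`
  have hinv : RCLike.re ((effLapU T M a ((L : ℝ) ^ 2) m2 U)⁻¹).det = (RCLike.re (effLapU T M a ((L : ℝ) ^ 2) m2 U).det)⁻¹ := by
    rw [Matrix.det_nonsing_inv, Ring.inverse_eq_inv', det_effLapU_eq_ofReal_re T M ha hc hm hU, ← RCLike.ofReal_inv, RCLike.ofReal_re, RCLike.ofReal_re]
  rw [hinv] at h1
  have hq : 0 < ((effLaplacian L M a ((L : ℝ) ^ 2) m2)⁻¹).trace / Fintype.card (Tor M) := div_pos htr hT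
  have h2 : ((((effLaplacian L M a ((L : ℝ) ^ 2) m2)⁻¹).trace / Fintype.card (Tor M)) ^ Fintype.card (Tor M × n))⁻¹ ≤ RCLike.re (effLapU T M a ((L : ℝ) ^ 2) m2 U).det := by
    rw [inv_le_comm₀ (pow_pos hq _) hΔ]
    exact h1
  rwa [← inv_pow, inv_div] at h2

omit hU in
/-- ★★ **THIS FLOOR IMPLIES PART Ϭ-b's**: `(a⁻¹+m⁻²)⁻¹ ≤ |T₁| ∕ tr (Δ^{(K)})⁻¹`. [cite: King1986, (2.14) p.653, (4.33) p.674, (4.45) p.675] -/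
theorem floor_king_ge_floor_sharp : (a⁻¹ + m2⁻¹)⁻¹ ≤ Fintype.card (Tor M) / ((effLaplacian L M a ((L : ℝ) ^ 2) m2)⁻¹).trace := by
  have htr := trace_effLaplacian_inv_pos M hL ha hm
  have hle := trace_effLaplacian_inv_le M hL ha hm
  have hT : (0 : ℝ) < Fintype.card (Tor M) := by exact_mod_cast Fintype.card_pos
  rw [le_div_iff₀ htr]
  calc (a⁻¹ + m2⁻¹)⁻¹ * ((effLaplacian L M a ((L : ℝ) ^ 2) m2)⁻¹).trace ≤ (a⁻¹ + m2⁻¹)⁻¹ * (Fintype.card (Tor M) * (a⁻¹ + m2⁻¹)) :=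
        mul_le_mul_of_nonneg_left hle (by positivity)
    _ = Fintype.card (Tor M) := by field_simp

end Floor

/-! ## §4 The curved block-field Gaussian integral is at most King's AM–GM value -/

section Gauss

variable {n : Type*} [Fintype n] [DecidableEq n] [Nonempty n]
variable (hL : 1 ≤ L) {a m2 : ℝ} (ha : 0 < a) (hm : 0 < m2) {U : Tor (fine L M) × Fin (d + 1) → Matrix n n ℝ} (hU : ∀ bd, U bd ∈ Matrix.unitaryGroup n ℝ)
include hL ha hm hU

/-- ★★★ **`𝒩(Δ_eff(U)) ≤ √(2π)^{N}·√((tr (Δ^{(K)})⁻¹ ∕ |T₁|)^{N})`** at every real-orthogonal background: the curved block-field Gaussian integral `∫e^{−½⟨ψ,Δ_eff(U)ψ⟩}dψ` is at most King's AM–GM value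
built from the flat diagonal covariance. [cite: King1986, (2.6) p.652, (3.89) p.668, (4.45) p.675; Balaban1982Higgs2, (3.37)–(3.38) p.591 (shape)] -/
theorem gaussNorm_effLapU_le_king :
    gaussNorm (effLapU T M a ((L : ℝ) ^ 2) m2 U)
      ≤ Real.sqrt (2 * Real.pi) ^ Fintype.card (Tor M × n) * Real.sqrt ((((effLaplacian L M a ((L : ℝ) ^ 2) m2)⁻¹).trace / Fintype.card (Tor M)) ^ Fintype.card (Tor M × n)) := by
  have hc : (0 : ℝ) ≤ (L : ℝ) ^ 2 := by positivity
  have hfloor := pow_le_re_det_effLapU_king T M hL ha hm hU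
  rw [RCLike.re_to_real] at hfloor
  have htr := trace_effLaplacian_inv_pos M hL ha hm
  have hT : (0 : ℝ) < Fintype.card (Tor M) := by exact_mod_cast Fintype.card_pos
  have hq : 0 < ((effLaplacian L M a ((L : ℝ) ^ 2) m2)⁻¹).trace / Fintype.card (Tor M) := div_pos htr hT
  have hfl : 0 < (Fintype.card (Tor M) / ((effLaplacian L M a ((L : ℝ) ^ 2) m2)⁻¹).trace) ^ Fintype.card (Tor M × n) := pow_pos (div_pos hT htr) _
  rw [gaussNorm_effLapU_eq T M ha hc hm hU, div_eq_mul_inv]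
  gcongr
  rw [← Real.sqrt_inv]
  apply Real.sqrt_le_sqrt
  have hdet : 0 < (effLapU T M a ((L : ℝ) ^ 2) m2 U).det := hfl.trans_le hfloor
  rw [inv_le_comm₀ hdet (pow_pos hq _), ← inv_pow, inv_div]
  exact hfloor

end Gauss

end Summit.QuantumFields.YangMills.BalabanUVNodes.N15KingModelRung.Analytic

end
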